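import Summits.HodgeConjecture.CorCM.B01.Transposition.Item6OmegaChiSplitting           -- ★ B01 `OmegaChiSplitting.chiLocalSplittingsD` (the Summits-side splitting package)
import Summits.HodgeConjecture.HodgeConjecture.Theorems.F0P2cOmegaLocalType              -- ★ p803803 `F0P2cOmegaLocalType.formCongr_frame` (the frame relation as `formCongr … (1 • H) = diag dV`)
import Literature.NumberTheory.Automorphic.Liu2021.Def411WeilCarriersLocalIsotypyAtPlace
import Literature.NumberTheory.Automorphic.UnitaryGroupPlaceInclusion
import Literature.NumberTheory.Automorphic.UnitaryGroupLocalCongr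
import Literature.NumberTheory.Automorphic.IrreducibleClassesComap
import Literature.NumberTheory.Rogawski1990.GlobalAPacketMembership
import Literature.NumberTheory.GelbartRogawski1991.CMThetaTypeVocabulary                -- ★ (this session) the shared vocabulary: `chiLocalSplittingsCM`, `xThetaCM`, `IsoAtXfCM`, `ThetaTypeAtCM`, `GRDMatrixCM`
import HarnessLib

/-!
# Crux `H413` · programme P2 · the VOCABULARY BRIDGE: the sub-line's §1 predicates (`Cruxes/H413/Lines/F0_P2PKPiRung4.lean` v1.1, 2e54cdb2dda5824f)
# ARE the Literature vocabulary `GelbartRogawski1991/CMThetaTypeVocabulary.lean` — by `rfl` ∕ `Iff.rfl`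

Cell hodgecm-mathlib (D-0151), FLOOR 0, crux item H413 = stmt-HodgeConjecture-24833; DEAL (V) of F0P2-plan (g6) 2026-08-31T08:52:08Z.  THEOREMS ONLY
(five bridges; no `def`), kernel lane `--supports stmt-HodgeConjecture-24833 --as helper`.  HONEST LABEL: HC_CM is proved only modulo
the printed citations until rung 0 closes; this file proves NO mathematics — every theorem is `rfl` ∕ `Iff.rfl` (the last one `simp only [hP]; rfl`): it CERTIFIES IN THE KERNEL that the
Literature spelling (over `chiLocalSplittingsCM`, with the frame proof inlined) is DEFINITIONALLY the Lines spelling (over ★ B01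
`OmegaChiSplitting.chiLocalSplittingsD ⟨L⟩` and ★ `F0P2cOmegaLocalType.formCongr_frame`), so that (i) the two printed letters U′-N
(`GR91Lemma512NonsplitAsPrinted`, director s515 (2)) and D7α (`xiEnvelope_nonsplit_isThetaType`, s511∕s514 (2)) can be stated in `Literature/` over the
vocabulary BY NAME, and (ii) the registrar's folds in the sub-line (`stub_GRD := …`, `stub_RIGf := …`) are ONE `exact` each (the elaborator accepts
`GRDMatrixCM …` where `GRDMatrix …` is expected, and `IsoAtXfCM …` where `IsoAtXf …` is expected).  `Cruxes/…/Lines` modules are never imported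
(O50-1): the Lines bodies are PASTED here as the left-hand sides (for `GRDMatrix`, whose body mentions the Lines predicate `ThetaTypeAt`, that predicate is ABSTRACTED as a parameter `P` with `P ↔ ThetaTypeAtCM`).

* `chiLocalSplittingsD_eq_CM` — ★ B01 `chiLocalSplittingsD ⟨L⟩ e₁ dV hdV hdV0 θ hθ ε = chiLocalSplittingsCM L e₁ dV hdV hdV0 θ hθ ε` (`rfl`, every `θ`);
* `xTheta_eq_CM` — the X′-term of `IsoAtXf` (v1.1 :214–245, pasted) `= xThetaCM L e₁ dV hdV hdV0 μ hμ χf ε v` (`rfl`);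
* `isoAtXf_iff_CM` — `‹IsoAtXf body, pasted› ↔ IsoAtXfCM …` (`Iff.rfl`);
* `thetaTypeAt_iff_CM` — `‹ThetaTypeAt body, pasted› ↔ ThetaTypeAtCM …` (`Iff.rfl`);
* `grdMatrix_iff_CM_of` — `‹GRDMatrix body, pasted, `ThetaTypeAt … μ hμ χf` abstracted as `P`› ↔ GRDMatrixCM …` given `P ε v c ↔ ThetaTypeAtCM …` (`simp only [hP]; rfl`).

[cite: GelbartRogawski1991, §3.1 Prop. 3.1.1; §5.1 (5.1.1), Lem 5.1.2 p. 466] [cite: Liu2021, Def. 4.11 (l. 2090–2096)] [cite: PlatonovRapinchuk1994, §2.3]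
-/

set_option autoImplicit false
-- the mandated namespace has the single-problem summit's repeated segment (`HodgeConjecture.HodgeConjecture`)
set_option linter.dupNamespace false

noncomputable section

open NumberField MeasureTheory IsDedekindDomain
open scoped Matrix ComplexOrder
namespace Summit.HodgeConjecture.HodgeConjecture.Cruxes.H413.F0P2iVocabularyBridge

open Literature.NumberTheory Literature.NumberTheory.Automorphic Literature.NumberTheory.Automorphic.UnitaryGroup
open Literature.NumberTheory.Automorphic.IdeleClassGroup
open Literature.NumberTheory.Automorphic.Liu2021 Literature.NumberTheory.Automorphic.Liu2021.Def411WeilCarriers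
open Literature.NumberTheory.Automorphic.Liu2021.Def411WeilCarriersDoubling
open Literature.NumberTheory.GelbartRogawski1991 Literature.NumberTheory.GelbartRogawski1991.UnitaryDualPair
open Literature.NumberTheory.GelbartRogawski1991.UnitaryDualPair.WeilCoinv
open Literature.RepresentationTheory Literature.RepresentationTheory.Liu2021 Literature.RepresentationTheory.HarrisKudlaSweet1996
open Literature.NumberTheory.GaloisRepresentations
open Literature.NumberTheory.Rogawski1990
open Summit.HodgeConjecture.CorCM.Transposition

set_option synthInstance.maxHeartbeats 400000 in
set_option maxHeartbeats 8000000 in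
/-- **The Summits-side splitting package IS the Literature one**: ★ B01 `OmegaChiSplitting.chiLocalSplittingsD ⟨L⟩ …` and `chiLocalSplittingsCM L …`
have the same body (`rfl`), for EVERY unitary splitting character `θ`. [cite: GelbartRogawski1991, §3.1 Prop. 3.1.1 p. 455 L1–3] -/
theorem chiLocalSplittingsD_eq_CM (L : Type) [Field L] [NumberField L] [IsCMField L] {n' : ℕ} (e₁ : Fin 3 × Fin 1 ≃ Fin n') (dV : Fin 3 → L)
    (hdV : ∀ i, IsCMField.complexConj L (dV i) = dV i) (hdV0 : ∀ i, dV i ≠ 0)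
    (θ : HeckeCharacter L) (hθ : IsSplittingChar L 1 θ) (ε : (↥(maximalRealSubfield L))ˣ) :
    OmegaChiSplitting.chiLocalSplittingsD ⟨L⟩ e₁ dV hdV hdV0 θ hθ ε = chiLocalSplittingsCM L e₁ dV hdV hdV0 θ hθ ε :=
  rfl

set_option synthInstance.maxHeartbeats 400000 in
set_option maxHeartbeats 8000000 in
/-- **The X′-term of the sub-line IS `xThetaCM`**: Liu's local theta type `X_v(μ, ε, χ_f)` spelled over ★ B01 `chiLocalSplittingsD ⟨L⟩` (the text of
`IsoAtXf` v1.1 :214–245, pasted) equals the Literature `xThetaCM L e₁ dV hdV hdV0 μ hμ χf ε v` (`rfl`). [cite: Liu2021, Def. 4.11 (l. 2090–2096)] -/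
theorem xTheta_eq_CM (L : Type) [Field L] [NumberField L] [IsCMField L] {n' : ℕ} (e₁ : Fin 3 × Fin 1 ≃ Fin n') (dV : Fin 3 → L)
    (hdV : ∀ i, IsCMField.complexConj L (dV i) = dV i) (hdV0 : ∀ i, dV i ≠ 0)
    (μ : Literature.NumberTheory.Automorphic.IdeleClassGroup L →ₜ* Circle) (hμ : IsConjugateSymplectic L μ)
    (χf : UnitaryGroup.finAdelicOne (↥(maximalRealSubfield L)) L (IsCMField.complexConj L) →* ℂˣ) (ε : (↥(maximalRealSubfield L))ˣ)
    (v : HeightOneSpectrum (𝓞 ↥(maximalRealSubfield L))) :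
    (show Representation ℂ (localPi L (IsCMField.complexConj L) 3 (Matrix.diagonal dV) v) _ from
        (TwistedCoinv.rep (localCharOfCenter (↥(maximalRealSubfield L)) L (IsCMField.complexConj L)
            (JW (↥(maximalRealSubfield L)) L ε) (JW_apply_ne_zero (↥(maximalRealSubfield L)) L ε) χf v)
          ((OmegaChiSplitting.chiLocalSplittingsD ⟨L⟩ e₁ dV hdV hdV0 (toHeckeCharacter L μ)
            ((isOscillatorChar_toHeckeCharacter_iff μ).mpr hμ) ε).omegaLoc v)
          (commute_omegaLoc_localCenter (↥(maximalRealSubfield L)) L (IsCMField.complexConj L) 3 e₁ (Matrix.diagonal dV)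
            (JW (↥(maximalRealSubfield L)) L ε) (complexConj_imagUnit L) (imagUnit_ne_zero L) (imagUnit_mul_self L)
            (realDiagonal_isSymm L dV hdV) (isSymm_TW (↥(maximalRealSubfield L)) ε) (realDiagonal_map L dV hdV).symm
            (JW_eq (↥(maximalRealSubfield L)) L ε) (JW_apply_ne_zero (↥(maximalRealSubfield L)) L ε)
            (OmegaChiSplitting.chiLocalSplittingsD ⟨L⟩ e₁ dV hdV hdV0 (toHeckeCharacter L μ)
              ((isOscillatorChar_toHeckeCharacter_iff μ).mpr hμ) ε) v)).comp
          (UnitaryGroup.localLineInl L (IsCMField.complexConj L) 3 e₁ (Matrix.diagonal dV) (JW (↥(maximalRealSubfield L)) L ε) v)) =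
      xThetaCM L e₁ dV hdV hdV0 μ hμ χf ε v :=
  rfl

set_option synthInstance.maxHeartbeats 400000 in
set_option maxHeartbeats 8000000 in
/-- **`IsoAtXf ↔ IsoAtXfCM`** — the sub-line's «`σ ∘ inclPlace v` is `X_v(μ,ε,χf) ∘ κ_v⁻¹`-isotypic» (v1.1 :214 body, pasted as the left-hand side)
is the Literature predicate, by `Iff.rfl`. [cite: Liu2021, Def. 4.11 (l. 2090–2096)] [cite: PlatonovRapinchuk1994, §2.3] -/
theorem isoAtXf_iff_CM (L : Type) [Field L] [NumberField L] [IsCMField L] (H : Matrix (Fin 3) (Fin 3) L) {n' : ℕ} (e₁ : Fin 3 × Fin 1 ≃ Fin n') (dV : Fin 3 → L)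
    (hdV : ∀ i, IsCMField.complexConj L (dV i) = dV i) (hdV0 : ∀ i, dV i ≠ 0) (g : GL (Fin 3) L)
    (hg : ((g : Matrix (Fin 3) (Fin 3) L).map (cmConjRingHom L))ᵀ * H * (g : Matrix (Fin 3) (Fin 3) L) = Matrix.diagonal dV)
    {W : Type} [AddCommGroup W] [Module ℂ W] (σ : Representation ℂ (finAdelic (↥(maximalRealSubfield L)) L (IsCMField.complexConj L) 3 H) W)
    (μ : Literature.NumberTheory.Automorphic.IdeleClassGroup L →ₜ* Circle) (hμ : IsConjugateSymplectic L μ)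
    (χf : UnitaryGroup.finAdelicOne (↥(maximalRealSubfield L)) L (IsCMField.complexConj L) →* ℂˣ) (ε : (↥(maximalRealSubfield L))ˣ)
    (v : HeightOneSpectrum (𝓞 ↥(maximalRealSubfield L))) :
    (isotypicComponent (MonoidAlgebra ℂ (localPi L (IsCMField.complexConj L) 3 H v))
    (Representation.asModule (σ.comp (inclPlace (↥(maximalRealSubfield L)) L (IsCMField.complexConj L) 3 H v)))
    (Representation.asModule
      (((show Representation ℂ (localPi L (IsCMField.complexConj L) 3 (Matrix.diagonal dV) v) _ from
        (TwistedCoinv.rep (localCharOfCenter (↥(maximalRealSubfield L)) L (IsCMField.complexConj L)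
            (JW (↥(maximalRealSubfield L)) L ε) (JW_apply_ne_zero (↥(maximalRealSubfield L)) L ε) χf v)
          ((OmegaChiSplitting.chiLocalSplittingsD ⟨L⟩ e₁ dV hdV hdV0 (toHeckeCharacter L μ)
            ((isOscillatorChar_toHeckeCharacter_iff μ).mpr hμ) ε).omegaLoc v)
          (commute_omegaLoc_localCenter (↥(maximalRealSubfield L)) L (IsCMField.complexConj L) 3 e₁ (Matrix.diagonal dV)
            (JW (↥(maximalRealSubfield L)) L ε) (complexConj_imagUnit L) (imagUnit_ne_zero L) (imagUnit_mul_self L)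
            (realDiagonal_isSymm L dV hdV) (isSymm_TW (↥(maximalRealSubfield L)) ε) (realDiagonal_map L dV hdV).symm
            (JW_eq (↥(maximalRealSubfield L)) L ε) (JW_apply_ne_zero (↥(maximalRealSubfield L)) L ε)
            (OmegaChiSplitting.chiLocalSplittingsD ⟨L⟩ e₁ dV hdV hdV0 (toHeckeCharacter L μ)
              ((isOscillatorChar_toHeckeCharacter_iff μ).mpr hμ) ε) v)).comp
          (UnitaryGroup.localLineInl L (IsCMField.complexConj L) 3 e₁ (Matrix.diagonal dV) (JW (↥(maximalRealSubfield L)) L ε) v)) :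
          localPi L (IsCMField.complexConj L) 3 (Matrix.diagonal dV) v →* _).comp
        (localCongr L (IsCMField.complexConj L) g one_ne_zero
          (F0P2cOmegaLocalType.formCongr_frame L H dV g hg) v).symm.toMulEquiv.toMonoidHom)) = ⊤) ↔
      IsoAtXfCM L H e₁ dV hdV hdV0 g hg σ μ hμ χf ε v :=
  Iff.rfl

set_option synthInstance.maxHeartbeats 400000 in
set_option maxHeartbeats 8000000 in
/-- **`ThetaTypeAt ↔ ThetaTypeAtCM`** — «the class `c` IS the theta type `X_v(μ,ε,χf) ∘ κ_v⁻¹`» (v1.1 :247 body, pasted as the left-hand side) is the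
Literature predicate, by `Iff.rfl`. [cite: GelbartRogawski1991, §5.1 (5.1.1), Lem 5.1.2 p. 466] -/
theorem thetaTypeAt_iff_CM (L : Type) [Field L] [NumberField L] [IsCMField L] (H : Matrix (Fin 3) (Fin 3) L) {n' : ℕ} (e₁ : Fin 3 × Fin 1 ≃ Fin n') (dV : Fin 3 → L)
    (hdV : ∀ i, IsCMField.complexConj L (dV i) = dV i) (hdV0 : ∀ i, dV i ≠ 0) (g : GL (Fin 3) L)
    (hg : ((g : Matrix (Fin 3) (Fin 3) L).map (cmConjRingHom L))ᵀ * H * (g : Matrix (Fin 3) (Fin 3) L) = Matrix.diagonal dV)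
    (μ : Literature.NumberTheory.Automorphic.IdeleClassGroup L →ₜ* Circle) (hμ : IsConjugateSymplectic L μ)
    (χf : UnitaryGroup.finAdelicOne (↥(maximalRealSubfield L)) L (IsCMField.complexConj L) →* ℂˣ) (ε : (↥(maximalRealSubfield L))ˣ)
    (v : HeightOneSpectrum (𝓞 ↥(maximalRealSubfield L))) (c : IrrClass ((cmDatum L 3 H).Local v)) :
    (∀ (T : Type) [AddCommGroup T] [Module ℂ T] (τ : Representation ℂ ↥(localPi L (IsCMField.complexConj L) 3 H v) T), τ.IsIrreducible →
    (IrrClass.comap (localPiEquiv L (IsCMField.complexConj L) 3 H v) c).IsConstituentOf τ →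
    ∀ (W' : Type) [AddCommGroup W'] [Module ℂ W'] (ρ' : Representation ℂ ↥(localPi L (IsCMField.complexConj L) 3 H v) W'),
      isotypicComponent (MonoidAlgebra ℂ (localPi L (IsCMField.complexConj L) 3 H v)) (Representation.asModule ρ')
          (Representation.asModule τ) = ⊤ →
      isotypicComponent (MonoidAlgebra ℂ (localPi L (IsCMField.complexConj L) 3 H v)) (Representation.asModule ρ')
        (Representation.asModule
          (((show Representation ℂ (localPi L (IsCMField.complexConj L) 3 (Matrix.diagonal dV) v) _ from
            (TwistedCoinv.rep (localCharOfCenter (↥(maximalRealSubfield L)) L (IsCMField.complexConj L)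
                (JW (↥(maximalRealSubfield L)) L ε) (JW_apply_ne_zero (↥(maximalRealSubfield L)) L ε) χf v)
              ((OmegaChiSplitting.chiLocalSplittingsD ⟨L⟩ e₁ dV hdV hdV0 (toHeckeCharacter L μ)
                ((isOscillatorChar_toHeckeCharacter_iff μ).mpr hμ) ε).omegaLoc v)
              (commute_omegaLoc_localCenter (↥(maximalRealSubfield L)) L (IsCMField.complexConj L) 3 e₁ (Matrix.diagonal dV)
                (JW (↥(maximalRealSubfield L)) L ε) (complexConj_imagUnit L) (imagUnit_ne_zero L) (imagUnit_mul_self L)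
                (realDiagonal_isSymm L dV hdV) (isSymm_TW (↥(maximalRealSubfield L)) ε) (realDiagonal_map L dV hdV).symm
                (JW_eq (↥(maximalRealSubfield L)) L ε) (JW_apply_ne_zero (↥(maximalRealSubfield L)) L ε)
                (OmegaChiSplitting.chiLocalSplittingsD ⟨L⟩ e₁ dV hdV hdV0 (toHeckeCharacter L μ)
                  ((isOscillatorChar_toHeckeCharacter_iff μ).mpr hμ) ε) v)).comp
              (UnitaryGroup.localLineInl L (IsCMField.complexConj L) 3 e₁ (Matrix.diagonal dV) (JW (↥(maximalRealSubfield L)) L ε) v)) :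
              localPi L (IsCMField.complexConj L) 3 (Matrix.diagonal dV) v →* _).comp
            (localCongr L (IsCMField.complexConj L) g one_ne_zero
              (F0P2cOmegaLocalType.formCongr_frame L H dV g hg) v).symm.toMulEquiv.toMonoidHom)) = ⊤) ↔
      ThetaTypeAtCM L H e₁ dV hdV hdV0 g hg μ hμ χf ε v c :=
  Iff.rfl

set_option synthInstance.maxHeartbeats 400000 in
set_option maxHeartbeats 8000000 in
/-- **`GRDMatrix ↔ GRDMatrixCM`, parametrised** — the finite Gelbart–Rogawski dictionary (v1.1 :285 body, pasted, with the Lines predicate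
`ThetaTypeAt … μ hμ χf` abstracted as `P`) is the Literature predicate `GRDMatrixCM` as soon as `P ε v c ↔ ThetaTypeAtCM … ε v c` — which the sub-line
instantiates at `P := ThetaTypeAt L H e₁ dV hdV hdV0 g hg μ hμ χf` with `hP := fun ε v c => thetaTypeAt_iff_CM …` (one delta-unfolding of its own `def`).
Stated this way the bridge elaborates without re-spelling the local theta type (the registrar's `.mp`∕`.mpr` is then instantaneous).
[cite: GelbartRogawski1991, §5.1 (5.1.1), Lem 5.1.2 p. 466] [cite: Rogawski1990, Lemma 4.13.1 (b) p. 62; §12.2 (2) p. 174] -/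
theorem grdMatrix_iff_CM_of (L : Type) [Field L] [NumberField L] [IsCMField L] (H : Matrix (Fin 3) (Fin 3) L) (hH : (H.map (cmConjRingHom L))ᵀ = H) (hHd : IsUnit H.det)
    {n' : ℕ} (e₁ : Fin 3 × Fin 1 ≃ Fin n') (dV : Fin 3 → L) (hdV : ∀ i, IsCMField.complexConj L (dV i) = dV i) (hdV0 : ∀ i, dV i ≠ 0) (g : GL (Fin 3) L)
    (hg : ((g : Matrix (Fin 3) (Fin 3) L).map (cmConjRingHom L))ᵀ * H * (g : Matrix (Fin 3) (Fin 3) L) = Matrix.diagonal dV)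
    (ξ : OneDimAutRepH L) (μω : HeckeCharacter L) (hμu : μω.IsUnitary)
    (μ : Literature.NumberTheory.Automorphic.IdeleClassGroup L →ₜ* Circle) (hμ : IsConjugateSymplectic L μ)
    (χf : UnitaryGroup.finAdelicOne (↥(maximalRealSubfield L)) L (IsCMField.complexConj L) →* ℂˣ)
    (P : ∀ (ε : (↥(maximalRealSubfield L))ˣ) (v : HeightOneSpectrum (𝓞 ↥(maximalRealSubfield L))), IrrClass ((cmDatum L 3 H).Local v) → Prop)
    (hP : ∀ (ε : (↥(maximalRealSubfield L))ˣ) (v : HeightOneSpectrum (𝓞 ↥(maximalRealSubfield L))) (c : IrrClass ((cmDatum L 3 H).Local v)),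
      P ε v c ↔ ThetaTypeAtCM L H e₁ dV hdV hdV0 g hg μ hμ χf ε v c) :
    ((∀ Pv : ∀ v : HeightOneSpectrum (𝓞 ↥(maximalRealSubfield L)), CMLocalAPacket L H v,
      ξ.IsXiLocalFamily hH hHd μω hμu Pv →
      ∀ (v : HeightOneSpectrum (𝓞 ↥(maximalRealSubfield L))),
        (∃ w : PlacesOver L v, IsCMField.complexConj L • w.1 ≠ w.1) →
        ∀ c : IrrClass ((cmDatum L 3 H).Local v), c ∈ (Pv v).members →
          ∃ ε : (↥(maximalRealSubfield L))ˣ, P ε v c) ∧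
  (∀ (v : HeightOneSpectrum (𝓞 ↥(maximalRealSubfield L))),
      (∀ w : PlacesOver L v, IsCMField.complexConj L • w.1 = w.1) →
      ∀ (T : GL (Fin 3) (UnitaryGroup.LocalRing L v)) (a : UnitaryGroup.LocalRing L v) (ha : IsUnit a)
        (h : formCongr (conjLocal L (IsCMField.complexConj L) v) T (H.map (algebraMap L (UnitaryGroup.LocalRing L v))) =
          a • (Matrix.of fun i j : Fin 3 => if i.val + j.val + 1 = 3 then (1 : L) else 0).map (algebraMap L (UnitaryGroup.LocalRing L v))),
        ∃ x₀ : IrrClass (Gqs L v),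
          x₀.IsConstituentOf (cmPrincipalSeries L 3 v (cmXiTorusChar L v (μω.semilocalComponent L v)
            (torusLocalComponent L (IsCMField.complexConj L) v ξ.η) (torusLocalComponent L (IsCMField.complexConj L) v ξ.ψ))) ∧
          ∃ ε : (↥(maximalRealSubfield L))ˣ,
            P ε v (IrrClass.comap (cmDatumLocalCongr L v T ha h).symm x₀))) ↔
      GRDMatrixCM L H hH hHd e₁ dV hdV hdV0 g hg ξ μω hμu μ hμ χf := by
  simp only [hP]
  rfl

end Summit.HodgeConjecture.HodgeConjecture.Cruxes.H413.F0P2iVocabularyBridge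

end
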